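import Summits.Ventures.YMGap.FlowData.RectTubeTransferOperator
import Summits.Ventures.LatticeQCDFlow.Scoring.SchwingerDysonOnePlaquette
import Literature.MathematicalPhysics.QuantumLattice.SU2Haar
import HarnessLib

/-!
# Venture YMGap — CONJECTURE «L-Y3-σ» (STRUCTURE.md §2 law #1 / §5; Sunday item (12)): the finite-volume
# TUBE STRING-TENSION LAW `E₁(Λ_⊥; β) < L_∥ · (−ln u(β))` for SU(2) Wilson tubes

HONEST FRAMING: venture file of the cell `pub-ymgap` (QuantumFields programme), track Y3 (FLOW-DATA).  This file
STATES a conjecture about FINITE spatial tori (femto-volumes) read off the cell's certified transfer-matrix rows; it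
proves nothing about it, and it says nothing about `L → ∞`, the continuum, a string tension or a mass gap.  Wording
of record (R202, lit-1 g6 + flow-theory 2026-08-23T01:52Z; typing authorised by the lead's Sunday item (12)):
«E₁(Λ_⊥; β) < L_∥ · (−ln u(β))» — the energy per unit time of one unit of `ℤ₂` electric flux winding an `L`-cycle
of the spatial torus is STRICTLY below its leading strong-coupling value `L · (−ln u)`, `u = I₂(β)/I₁(β)` the
one-plaquette character ratio.  Its in-tree-provable infinite-volume companion «σ(β) ≤ −log⟨(1/N) Re tr U_p⟩»
(Seiler 1978 / Bachas 1986; tree `StaticPotential.stringTension_le_neg_log_plaquette`) is a DIFFERENT inequality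
and is not restated here.  In slice dimension `k = 1` (theory dimension two) the law holds with EQUALITY
(`Census/TwoDimTransfer.transfer_two_character_eigen`: the transfer operator is diagonal in the characters of the
holonomy with eigenvalue `c_n^L`), so the strict law is typed for `k = 2` (the table's `d = 3` tubes `L × L`) with
the `k = 3` twin (`d = 4`, cubic cross-sections).

Objects (`FlowData/TubeTransferOperator.lean`, `FlowData/TorelonEnergy.lean`; conventions confirmed against
FLOW-PLAN v1.1 §1.2–§1.3 by flow-theory, 2026-08-23T07:08Z): `su2TorelonEnergy β k L μ = log ‖T‖ − log ‖T ∘ P_{ê_μ}‖`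
for the SU(2) tube transfer operator `T` on `(ℤ/L)^k` at Wilson coupling `β ≡ β_W` (FLOW-PLAN O1,
`E₁ = ln(λ̂₀/λ̂₀^{(e₁)})`, all momentum / point-group blocks of the flux sector included), and
`u(β) = ⟨cos α⟩_{sin²α e^{β cos α} dα} = I₂(β)/I₁(β)` (`su2CharacterRatio`).  The sector top `‖T ∘ P_{ê_μ}‖` is
carried as an explicit POSITIVITY CONJUNCT (`0 < tubeSectorNorm …`), so that the logarithm in `E₁` is never the junk
branch: `λ̂₀^{(e₁)} > 0` for `β > 0` is part of the content (true for the Wilson kernel — every character coefficient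
`a_j(β) > 0` — but not proved in the tree; at `β = 0` the flux sectors ARE annihilated and the law is not claimed).

EVIDENCE OF RECORD at typing time — point-wise PRE-REGISTERED sign predictions (P-E1-sign) scored HELD by flow-ref
wherever scored (FR-72), 0 exceptions; the instance list of record is flow-theory's
HOME/pub-ymgap-flow-theory/LY3SIGMA-INSTANCES.md (c89c2fa465ae98d2): 41 certified instances, all margins > 0 (rows
below from ROWS-FOR-DOCSTRING.md 54f0f1ab44c8b5ad, read off FLOW-TABLE.md a3de7fadbc985174; later passes of the
table only TIGHTEN these upper endpoints, e.g. 2×2 β = 1: E₁ ≤ 2.71761346 at pass g5); per row: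
`L`, `β_W`, certified upper endpoint of `E₁`, `L·(−ln u(β_W))` (float, = the registered threshold to printed
digits), margin, lineages (A = sntm / one-site exact, B = kstm, C = engine-3 exact one-site, ∩ = two-lineage).
Smallest margins at small `β` / large `L` (4×4 ¼: 1.37e-4; 4×4 ½: 2.4e-3; 3×3 ½: 5.0e-3), largest at 2×2 `β = 3`
(0.616) — tight exactly where the strong-coupling expansion `E₁ = L(−ln u) − O(uⁿ)` says; the 1² `β = 128` row
certifies `E₁ ∈ [−1.9e-9, 1.9e-9]`, so `E₁ < −ln u` holds there while `E₁ > 0` is not certified at that point.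
Falsifier: any certified row with `E₁ ≥ L(−ln u)`.

-- Certified instances for `TubeStringTensionLawDim3` (k = 2, (ℤ/L)², flux along axis 0) — 26, all strict:
--   L = 1 (1x1), β_W =  1/4: E₁ ≤ 2.715941377      < 2.7751861  (margin 0.0592; A+C+∩)
--   L = 1 (1x1), β_W =  1/2: E₁ ≤ 1.977775062      < 2.0897511  (margin 0.112; A+C+∩)
--   L = 1 (1x1), β_W =    1: E₁ ≤ 1.228468619      < 1.4263095  (margin 0.198; A+C+∩)
--   L = 1 (1x1), β_W =  3/2: E₁ ≤ 0.8090349816     < 1.0666951  (margin 0.258; A+C+∩)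
--   L = 1 (1x1), β_W =    2: E₁ ≤ 0.5438980275     < 0.8367233  (margin 0.293; A+C+∩)
--   L = 1 (1x1), β_W =  5/2: E₁ ≤ 0.3715884452     < 0.6788595  (margin 0.307; A+C+∩)
--   L = 1 (1x1), β_W =    3: E₁ ≤ 0.2588274179     < 0.5657683  (margin 0.307; A+C+∩)
--   L = 1 (1x1), β_W =    4: E₁ ≤ 0.1339348157     < 0.4184785  (margin 0.285; A)
--   L = 1 (1x1), β_W =    6: E₁ ≤ 0.04269318575    < 0.2708563  (margin 0.228; A)
--   L = 1 (1x1), β_W =    8: E₁ ≤ 0.01476831603    < 0.1993667  (margin 0.185; A)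
--   L = 1 (1x1), β_W =   12: E₁ ≤ 0.00199343741    < 0.1302805  (margin 0.128; A+C+∩)
--   L = 1 (1x1), β_W =   16: E₁ ≤ 0.0003211189857  < 0.0967148  (margin 0.0964; A+C+∩)
--   L = 1 (1x1), β_W =   32: E₁ ≤ 7.72515e-07      < 0.0476125  (margin 0.0476; A+C+∩)
--   L = 1 (1x1), β_W =   64: E₁ ≤ 9.22e-11         < 0.0236213  (margin 0.0236; A)
--   L = 1 (1x1), β_W =  128: E₁ ≤ 1.8841e-09       < 0.0117646  (margin 0.0118; A)
--   L = 2 (2x2), β_W =  1/4: E₁ ≤ 5.542495807      < 5.5503723  (margin 0.00788; A+B+∩)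
--   L = 2 (2x2), β_W =  1/2: E₁ ≤ 4.147312462      < 4.1795022  (margin 0.0322; A+B+∩)
--   L = 2 (2x2), β_W =    1: E₁ ≤ 2.717613892      < 2.8526190  (margin 0.135; A+B+∩)
--   L = 2 (2x2), β_W =  3/2: E₁ ≤ 1.833781704      < 2.1333902  (margin 0.3; A+B+∩)
--   L = 2 (2x2), β_W =    2: E₁ ≤ 1.203568302      < 1.6734466  (margin 0.47; A+B+∩)
--   L = 2 (2x2), β_W =  5/2: E₁ ≤ 0.7743043624     < 1.3577191  (margin 0.583; A)
--   L = 2 (2x2), β_W =    3: E₁ ≤ 0.5157178039     < 1.1315366  (margin 0.616; A)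
--   L = 3 (3x3), β_W =  1/2: E₁ ≤ 6.264257646      < 6.2692532  (margin 0.005; A+B+∩)
--   L = 3 (3x3), β_W =    1: E₁ ≤ 4.221519375      < 4.2789285  (margin 0.0574; B)
--   L = 4 (4x4), β_W =  1/4: E₁ ≤ 11.10060814      < 11.1007445 (margin 0.000137; B)
--   L = 4 (4x4), β_W =  1/2: E₁ ≤ 8.356619076      < 8.3590043  (margin 0.00239; B)
-- Certified instances for `TubeStringTensionLawDim4` (k = 3, (ℤ/L)³) — 11, all at L = 1 (1³); NO certified 2³ E₁ row
-- exists yet (flow-eng-4 lineage G ladder queued): «L ≥ 2 evidence pending» for the d = 4 twin.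
--   L = 1 (1x1x1), β_W = 1/4 … 8: E₁ ≤ 2.659495249 < 2.7751861 (¼; margin 0.116; A+C+∩) · 1.877418967 < 2.0897511 (½)
--   · 1.076936098 < 1.4263095 (1) · 0.6463526707 < 1.0666951 (3/2) · 0.3939253685 < 0.8367233 (2) · 0.2432413648 <
--   0.6788595 (5/2) · 0.1522887817 < 0.5657683 (3) · 0.06159642121 < 0.4184785 (4; A) · 0.0254681871 < 0.3294203 (5; A)
--   · 0.01067598316 < 0.2708563 (6; A) · 0.002017548245 < 0.1993667 (8; A)
-- Evidence only (asymmetric L₁×L₂ cross-sections = v2 objects, not instances of the Props below; E₁ along the SHORT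
-- cycle L = 2): 2x3 ½: 4.147077228 < 4.1795022 (A+B+∩) · 2x3 1: 2.714229016 < 2.8526190 (A+B+∩) · 2x4 ½: 4.147110992
-- < 4.1795022 (A+B+∩) · 2x4 ¾: 3.318194532 < 3.3937600 (B); long-cycle companions 2×3 ½: 6.263712 < 6.269253,
-- 2×3 1: 4.221732 < 4.278929, 2×4 ½: 8.356571 < 8.359004, 2×4 ¾: 6.775216 < 6.787520.

References: E. Seiler, Phys. Rev. D 18 (1978) 482; C. Bachas, Phys. Rev. D 33 (1986) 2723 (the infinite-volume
companion, cited for contrast only); G. 't Hooft, Nucl. Phys. B 153 (1979) 141 (electric flux on the torus)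
[cite: tHooft1979Flux]; G. Münster, Nucl. Phys. B 180 (1981) 23 (strong-coupling torelon / string tension
`−ln u + O(u⁴)`) [folklore].
-/

noncomputable section

open Summit.Ventures.YMGap.FlowData Summit.Ventures.LatticeQCDFlow.Scoring
open Literature.MathematicalPhysics.QuantumLattice (fundamentalRep)

namespace Summit.Ventures.YMGap.Conjectures

/-- The **one-plaquette character ratio** `u(β) = a_{1/2}(β) = I₂(β)/I₁(β) = ⟨½ Tr U_p⟩` of the SU(2)
one-plaquette model at Wilson coupling `β` (class-angle form: `⟨cos α⟩` under `sin² α · e^{β cos α} dα` on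
`[0, π]`); `−ln u(β)` is the leading strong-coupling torelon energy per plaquette. -/
def su2CharacterRatio (β : ℝ) : ℝ :=
  onePlaquetteExpectSU2 β Real.cos

/-- The **sector top** `λ₀^{(ê_μ)} = ‖T ∘ P_{ê_μ}‖` of the SU(2) tube transfer operator on `(ℤ/L)^k` at Wilson
coupling `β`: the largest point of the spectrum of `T` on the flux sector `ê_μ` (un-normalised; FLOW-PLAN's
`λ̂₀^{(e₁)}` up to the common positive scalar). -/
def su2SectorTop (β : ℝ) (k L : ℕ) [NeZero L] (μ : Fin k) : ℝ :=
  tubeSectorNorm (fundamentalRep (Fin 2)) su2MinusOne (β / 2) k L (Pi.single μ 1)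

/-- **CONJECTURE «L-Y3-σ» (d = 3 tubes).**  For every side `L ≥ 1` and every Wilson coupling `β > 0`, on the
spatial torus `(ℤ/L)²` the flux sector along an axis is not annihilated (`λ₀^{(e₁)} > 0`, so that `E₁` is a
genuine logarithm) AND the SU(2) torelon energy is strictly below its leading strong-coupling value:
`E₁((ℤ/L)²; β) < L · (−ln u(β))`.  [conjecture of the cell pub-ymgap, STRUCTURE.md §5 L-Y3-σ, wording of record
R202 (CONJECTURE of the cell; NOT in print); pre-registered point-wise as P-E1-sign; instances of record = the
symmetric `d = 3` rows of flow-theory's LY3SIGMA-INSTANCES.md c89c2fa465ae98d2 (26 of its 41 certified instances,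
listed in the module docstring; the `1³` rows instantiate `TubeStringTensionLawDim4`, the `2×3`/`2×4` rows
`TubeStringTensionLawDim3Rect`)] -/
@[conjecture] def TubeStringTensionLawDim3 : Prop :=
  ∀ (L : ℕ) [NeZero L] (β : ℝ), 0 < β →
    0 < su2SectorTop β 2 L 0 ∧
      su2TorelonEnergy β 2 L 0 < (L : ℝ) * (-Real.log (su2CharacterRatio β))

/-- **CONJECTURE «L-Y3-σ» (d = 4 twin, cubic cross-sections `(ℤ/L)³`).**  Same sentence one dimension up
(certified instances of record: the one-site torus `1³` at `β = ¼ … 8`; `L ≥ 2` evidence pending; CONJECTURE of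
the cell, NOT in print). -/
@[conjecture] def TubeStringTensionLawDim4 : Prop :=
  ∀ (L : ℕ) [NeZero L] (β : ℝ), 0 < β →
    0 < su2SectorTop β 3 L 0 ∧
      su2TorelonEnergy β 3 L 0 < (L : ℝ) * (-Real.log (su2CharacterRatio β))

/-- **CONJECTURE «L-Y3-σ», rectangular twin (d = 3 tubes `L₁ × L₂`, flux along either axis).**  For every
rectangular cross-section `ℤ/L₁ × ℤ/L₂`, every Wilson coupling `β > 0` and each axis `μ`, the flux sector `ê_μ` is
not annihilated AND the torelon energy of one unit of flux winding the `μ`-cycle (length `L_μ`) is strictly below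
`L_μ · (−ln u(β))` — the table's `E1` (short axis) and `E1_axis1` (long axis) rows of the `2×3`, `2×4` tubes are
instances (two-lineage at 2×3 ½, 1 and 2×4 ½; flow-theory 2026-08-23T07:42Z).  It implies the cubic law
(`tubeStringTensionLawDim3_of_rect`). [conjecture of the cell pub-ymgap, STRUCTURE.md §5 L-Y3-σ; NOT in print] -/
@[conjecture] def TubeStringTensionLawDim3Rect : Prop :=
  ∀ (Ls : Fin 2 → ℕ) [∀ i, NeZero (Ls i)] (β : ℝ), 0 < β → ∀ μ : Fin 2,
    0 < su2RectSectorTop β Ls μ ∧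
      su2RectTorelonEnergy β Ls μ < (Ls μ : ℝ) * (-Real.log (su2CharacterRatio β))

/-- The rectangular law implies the cubic one (constant sides `Ls = fun _ => L`, axis `0`; the rectangular objects
ARE the cubic ones there, `FlowData.su2RectTorelonEnergy_const`). [folklore] -/
theorem tubeStringTensionLawDim3_of_rect (h : TubeStringTensionLawDim3Rect) : TubeStringTensionLawDim3 := by
  intro L _ β hβ
  exact h (fun _ : Fin 2 => L) β hβ 0

/-- Unfolding the `d = 3` law at one point: the torelon-energy clause is literally
`log ‖T‖ − log ‖T ∘ P_{ê₀}‖ < L · (−log u(β))` for the SU(2) tube operator `T` on `(ℤ/L)²`. [folklore] -/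
theorem tubeStringTensionLawDim3_iff :
    TubeStringTensionLawDim3 ↔ ∀ (L : ℕ) [NeZero L] (β : ℝ), 0 < β →
      0 < ‖(su2TubeTransferOperator β 2 L).comp (tubeFluxProjection su2MinusOne 2 L (Pi.single 0 1))‖ ∧
        Real.log ‖su2TubeTransferOperator β 2 L‖ -
            Real.log ‖(su2TubeTransferOperator β 2 L).comp (tubeFluxProjection su2MinusOne 2 L (Pi.single 0 1))‖ <
          (L : ℝ) * (-Real.log (onePlaquetteExpectSU2 β Real.cos)) :=
  Iff.rfl

/-- **`u(β) > 0` for `β > 0`** (one-plaquette Schwinger–Dyson identity `3⟨cos α⟩ = β⟨sin² α⟩` of the tree and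
`⟨sin² α⟩ > 0`), so that `−log u(β)` in the law is a genuine logarithm. [folklore] -/
theorem su2CharacterRatio_pos {β : ℝ} (hβ : 0 < β) : 0 < su2CharacterRatio β := by
  have hsd := three_mul_expect_cos_eq_beta_mul_expect_sin_sq_su2 β
  have hsin : 0 < onePlaquetteExpectSU2 β (fun α => Real.sin α ^ 2) := by
    unfold onePlaquetteExpectSU2
    refine div_pos ?_ (onePlaquetteZSU2_pos β)
    refine intervalIntegral.intervalIntegral_pos_of_pos_on ?_ (fun x hx => ?_) Real.pi_pos
    · exact (by fun_prop : Continuous fun α => Real.sin α ^ 2 * (Real.sin α ^ 2 * Real.exp (β * Real.cos α))).intervalIntegrable _ _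
    · have hs : 0 < Real.sin x := Real.sin_pos_of_pos_of_lt_pi hx.1 hx.2
      positivity
  have h3 : 0 < 3 * onePlaquetteExpectSU2 β Real.cos := by rw [hsd]; exact mul_pos hβ hsin
  unfold su2CharacterRatio
  linarith

/-- **Multiplicative (log-free) reading of the `d = 3` law**: at every point it says that the flux-sector top
exceeds `u(β)^L` times the vacuum value, `‖T‖ · u(β)^L < ‖T ∘ P_{ê₀}‖` — equivalently
`λ̂₀^{(e₁)}/λ̂₀ > u^L`, i.e. `E₁ < L · (−ln u)`. [folklore] -/
theorem tubeStringTensionLawDim3_iff_mul :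
    TubeStringTensionLawDim3 ↔ ∀ (L : ℕ) [NeZero L] (β : ℝ), 0 < β →
      ‖su2TubeTransferOperator β 2 L‖ * su2CharacterRatio β ^ L < su2SectorTop β 2 L 0 := by
  haveI : SecondCountableTopology (Matrix.specialUnitaryGroup (Fin 2) ℂ) :=
    Literature.MathematicalPhysics.QuantumLattice.secondCountableTopology_su2
  have hT : ∀ (L : ℕ) [NeZero L] (β : ℝ), 0 < ‖su2TubeTransferOperator β 2 L‖ := fun L _ β =>
    norm_tubeTransferOperator_pos (β / 2) 2 L
      (Literature.MathematicalPhysics.QuantumLattice.continuous_fundamentalRep (Fin 2))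
  have key : ∀ (L : ℕ) [NeZero L] (β : ℝ), su2TorelonEnergy β 2 L 0 =
      Real.log ‖su2TubeTransferOperator β 2 L‖ - Real.log (su2SectorTop β 2 L 0) := fun L _ β => rfl
  refine ⟨fun h L _ β hβ => ?_, fun h L _ β hβ => ?_⟩
  · obtain ⟨hpos, hlt⟩ := h L β hβ
    rw [key] at hlt
    have hu := su2CharacterRatio_pos hβ
    -- `log ‖T‖ − log s < L · (−log u)` ⇔ `log (‖T‖ u^L) < log s`
    have h1 : Real.log (‖su2TubeTransferOperator β 2 L‖ * su2CharacterRatio β ^ L) <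
        Real.log (su2SectorTop β 2 L 0) := by
      rw [Real.log_mul (hT L β).ne' (pow_pos hu L).ne', Real.log_pow]
      linarith
    exact (Real.log_lt_log_iff (mul_pos (hT L β) (pow_pos hu L)) hpos).1 h1
  · have hu := su2CharacterRatio_pos hβ
    have hlt := h L β hβ
    have hpos : 0 < su2SectorTop β 2 L 0 := (mul_pos (hT L β) (pow_pos hu L)).trans hlt
    refine ⟨hpos, ?_⟩
    have h1 := (Real.log_lt_log_iff (mul_pos (hT L β) (pow_pos hu L)) hpos).2 hlt
    rw [Real.log_mul (hT L β).ne' (pow_pos hu L).ne', Real.log_pow] at h1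
    rw [key]
    linarith

end Summit.Ventures.YMGap.Conjectures
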